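import Summits.QuantumFields.YangMills.Theorems.BalabanUVNodesN15PerCubeGreenFineTransport
import HarnessLib

/-!
# N15 = NE2, road (c) — PROGRAMME (PC) «[B9] Sect. C FOR THE LANDAU LETTER WITH PER-CUBE GAUGES (3.35) AS PRINTED», (PC-E″): THE η-DEFECT OF BAŁABAN's PROPAGATOR FOR
# BACKGROUNDS IN THE PER-CUBE CLASS ON THE TWO GRIDS REDUCED EXACTLY TO THE η-DEFECT OF HIS OPERATOR — `𝔇(G′,G) = −G′·𝔇(A′,A)·G` with the per-cube inverses of n15-c∕321 on
# both grids, for ARBITRARY two-grid transports; «rate = stability × consistency» (dag-n15-c g31, n15-c∕328)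

Cell `pub-ymgap`, seat `pub-ymgap-dag-n15-c` (generation g31; R134 (a) seat, strategy s1 «first missing estimate»; HUMAN RULING D-0062; chair R424 venue).
`bears_on: R4∕N15 · K3⁸ SpineGivenEndpointR13SepCoPHV (stmt-QuantumFields-27366)`; filed `--kind proof --supports stmt-QuantumFields-27366 --as helper` — COUNT-NEUTRAL.
ONE theorem, 0 `def`, 0 `sorry`; bookkeeping over landed theorems, NO new estimate.  Imports BY NAME n15-c∕327 `…PerCubeGreenFineTransport` (`exists_inverse_decay_of_reg335Cube_twoGrid`
= n15-c∕321 on both grids under one constant block; through it the coarse∕fine bond objects `CvX`∕`CvNorm`∕`cvNL`∕`cvNVq`∕`cvNVr` and `CvX'`∕`cvNL'`∕`cvNVq'`∕`cvNVr'`, dag-n15-a's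
pairing `kingPrV`) and, through its closure, pub-balaban's `T4EtaRateDefect` (`idef`, `idef_inv` «the exact inverse rule», `idef_inv_majorant` «rate = stability × consistency»),
`B9SectDWeightedNeumann` (`WRow`, `wrow_of_exp`), `B6UnitTorusCarrier` (`rowSum_unitTorusGeo`, `triangle254_unitTorusGeo`, `unitTorusGeo_dist_nonneg`).  Nothing in the tree
is modified, no landed name re-declared.

WHY (HOME HANDOFF § g30 «(PC-E) OPEN» + this seat's g31 analysis `PCE-DESIGN-g31.md`).  (PC-E) = the two-spacing η-defect, per cube, of the R-part — equivalently (T4EtaRate's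
operator layer) an η-rate for `G(U′)∘τ − τ∘G(U)` where `G = (Δ_{R_U} + aQ*(U)Q(U) − D_U(I−R(U))D*_U)⁻¹` is Bałaban's propagator, `U′` lives on the fine torus (spacing
`L^{−r}L^{−k}`), `U` on the coarse one (`L^{−k}`), and `τ` transports coarse 1-forms to fine ones.  Two design questions are the planner's (§ g30: the PAIRING `U ↔ U′`; and —
located by this seat, g31 — the TRANSPORT `τ`: for the per-cube class a flat block pull-back cannot give an η-rate uniformly (pure gauges with a rough gauge function are in the
class and make `G(U′)τ − τG(U)` of order one), a covariant pull-back can).  THIS FILE proves the part of (PC-E) that is INDEPENDENT of both answers: by pub-balaban's exact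
inverse rule `𝔇(G′,G) = −G′𝔇(Δ′,Δ)G` (`T4EtaRateDefect.idef_inv`: a left inverse on the fine grid and a right inverse on the coarse grid suffice — n15-c∕321 gives two-sided
inverses on both) the η-defect of the PROPAGATORS through ANY pair of linear transports `τ₁, τ₂` IS the η-defect of the OPERATORS (explicit, finite-range-plus-Landau-part objects)
sandwiched between the two decaying inverses; and by `idef_inv_majorant` with the unit-torus row sum (2.61) any source-weighted majorant `N_Δ(y,y′)·ε` of the operator defect
with `‖N_Δ‖_{δ∕32} ≤ m_Δ` yields the majorant `(B·c₁)(m_Δ·B)·e^{−(δ∕32)d}·ε` of the propagator defect — «rate = stability × consistency», the stability being n15-c∕321 on both grids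
with ONE constant block (n15-c∕327), the consistency (the operator defect, where the pairing and the transport enter) DISPLAYED.  So (PC-E) for the propagator is reduced, once and
for all designs, to the η-defect rows of `Δ_{R_U}`, `N_L`, `N_V^Q(U)` (n15-c∕326: box-local two-grid rows landed) and `N_V^R(U)` (the R-part: the per-cube Landau letter).

WHAT THIS FILE PROVES (kernel).  ★★★★ `idef_inverse_of_reg335Cube_twoGrid`: constants `δ, B, c₁ = K_{d+1}(δ∕32)` (and `ε₀(e), w₂(e)`) fixed once; for every `k ≥ 1`, `r`, every
coarse `U` and fine `U′` in r06's `Reg335Cube` on the locality boxes with `C∕ξ, C∕ξ² ≤ ε₀` (the two fields UNRELATED), Bałaban's operators `A`, `A′` (named by hypotheses `A = …`,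
`A′ = …`, instantiate with `rfl`) have inverses `G`, `G′` with `HasMaj ≤ B e^{−(δ∕16)d}` on the respective grids (fine blocks through `kingPrV`), and for ALL linear
`τ₁ τ₂ : (coarse 1-forms) → (fine 1-forms)`: (i) `idef τ₁ τ₂ G′ G = −(G′ ∘ idef τ₂ τ₁ A′ A ∘ G)`; (ii) `HasMaj (idef τ₂ τ₁ A′ A) (N_Δ·ε)` with `N_Δ ≥ 0`, `ε ≥ 0`,
`WRow (δ∕32) N_Δ m_Δ` ⟹ `HasMaj (idef τ₁ τ₂ G′ G) ((B c₁)(m_Δ B) e^{−(δ∕32)d}·ε)`.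

HONEST FRAMING ∕ LIMITS.  Algebra + row-sum bookkeeping over n15-c∕321∕327 and pub-balaban's `T4EtaRateDefect`; the operator defect row is a HYPOTHESIS (it is (PC-E) proper);
no pairing between `U` and `U′` is assumed or constructed; `ε` is a free constant (the η-rate factor of a one-scale geometry is site-independent, `T4EtaRate.rateFactor_unit`), NOT
derived; MODEL carriers (doubled-cube torus cover, one averaging level, unit weights, per-cube gauges from `Reg335Cube`); [Balaban1985BackgroundPropagators] Thm 3.3 p.398, (3.35)
p.396, Thm 3.14 pp.426–427 (the «difference satisfies all the inequalities … with the additional factor» template) and [King1986] Prop. 3.9 (3.73) p.665, p.664 = SHAPES ∕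
MECHANISM, nothing printed is asserted.  NE2⁺ NOT PRINTED, NOT proved; N15 of record untouched (DISCHARGED AS CONSUMED, p687738); K3⁸ OPEN; counts of record UNMOVED (typed
28∕28 · discharged 8∕27); one finite 𝕋⁴ at fixed ε per index — NOT infinite volume, NOT OS on ℝ⁴, NOT a mass gap, NOT Clay; R4 closes the conditional finite-𝕋⁴ rung
`BalabanLadder.UV` only.  Restate-immune (no Theses import).
-/

noncomputable section

open scoped BigOperators Matrix Matrix.Norms.L2Operator

namespace Summit.QuantumFields.YangMills.BalabanUVNodes.N15.Gluing

open Real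
open Literature.MathematicalPhysics.QuantumFieldTheory.Balaban1983to89
open Literature.MathematicalPhysics.QuantumFieldTheory.Balaban1983to89.B5Prop11Plancherel (Tor fine unitVec)
open Literature.MathematicalPhysics.QuantumFieldTheory.Balaban1983to89.B11SectG (BlockNorm HasMaj)
open Literature.MathematicalPhysics.QuantumFieldTheory.Balaban1983to89.B6UnitTorusCarrier (unitTorusGeo rowSum_unitTorusGeo triangle254_unitTorusGeo unitTorusGeo_dist_nonneg)
open Literature.MathematicalPhysics.QuantumFieldTheory.Balaban1983to89.B9SectDWeightedNeumann (WRow wrow_of_exp)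
open Literature.MathematicalPhysics.QuantumFieldTheory.Balaban1983to89.B9Eq335RegularityClasses (Reg335Cube)
open Literature.MathematicalPhysics.QuantumFieldTheory.Balaban1983to89.T4EtaRateDefect (idef idef_inv idef_inv_majorant slowWeight_const)
open Literature.MathematicalPhysics.QuantumFieldTheory.King1986.Torus (blockOf)
open Literature.Barriers.QuantumFields (traceForm)
open Summit.QuantumFields.YangMills.BalabanUVNodes.N15.BackgroundLayer (covLapM)
open Summit.QuantumFields.YangMills.BalabanUVNodes.N15.MatrixSpecies (coordMat liftBlk)
open Summit.QuantumFields.YangMills.BalabanUVNodes.N15.VectorPiece (bshiftEquiv kingPrV)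
open Summit.QuantumFields.YangMills.BalabanUVNodes.N15.TwoGrid (cubeBlocks)
open Summit.QuantumFields.YangMills.BalabanUVNodes.N15.CurvedSpecies (gaugePair)

variable {d : ℕ} {L : ℕ} [NeZero L]

/-! ## Rate = stability × consistency for Bałaban's propagator on the two grids of the pairing -/

section Resolvent

/-- ★★★★ **THE η-DEFECT OF BAŁABAN's PROPAGATOR FOR BACKGROUNDS IN THE PER-CUBE CLASS ON THE TWO GRIDS, REDUCED EXACTLY TO THE η-DEFECT OF HIS OPERATOR** — for arbitrary
two-grid transports `τ₁, τ₂`: the inverses of n15-c∕321 on both grids (one constant block, n15-c∕327), the exact inverse rule `𝔇(G′,G) = −G′𝔇(A′,A)G`, and the passage of any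
source-weighted majorant of `𝔇(A′,A)` to `𝔇(G′,G)` («rate = stability × consistency»). [cite: Balaban1985BackgroundPropagators, Thm 3.3 p.398 with (3.35) p.396 per cube, Thm 3.14
pp.426–427 (difference template: shape); King1986, Prop. 3.9 (3.73) p.665 (η-rate shape), p.664 (pairing); Balaban1984PropagatorsII, Lemma 2.1 (2.61) p.234] -/
theorem idef_inverse_of_reg335Cube_twoGrid (hL : Odd L ∧ 1 < L) (hL17 : 17 ≤ L) {a₀ : ℝ} (ha₀ : 0 < a₀) {a : ℝ} (ha : 0 < a) (ι : Type) [Fintype ι] [DecidableEq ι] :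
    ∃ δ B c₁ : ℝ, 0 < δ ∧ 0 < B ∧ 0 < c₁ ∧
      ∀ {mm : Type} [Fintype mm] [DecidableEq mm] [Nonempty mm] (e : Matrix mm mm ℂ ≃L[ℝ] (ι → ℝ)), (∀ A B : Matrix mm mm ℂ, traceForm A B = e A ⬝ᵥ e B) →
      ∃ ε₀ w₂ : ℝ, 0 < ε₀ ∧
      ∀ (mv kk r : ℕ), 1 ≤ kk → w₂ ≤ ((L ^ mv : ℕ) : ℝ) →
      -- the COARSE field (spacing `L^{−k}`) in the per-cube class on the locality boxes
      ∀ (U : Fin (d + 1) → ScX d L mv kk hL → (Matrix mm mm ℂ)ˣ), (∀ μ x, (U μ x : Matrix mm mm ℂ) ∈ Matrix.unitaryGroup mm ℂ) →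
      ∀ (ξ C : ℝ), 0 < ξ → 0 < C → C / ξ ≤ ε₀ → C / ξ ^ 2 ≤ ε₀ →
        (∀ k : Fin (d + 1) → ZMod (2 * L), Reg335Cube (scShift d L mv kk hL) U ((((L ^ kk : ℕ) : ℝ))⁻¹) {x : ScX d L mv kk hL | blockOf (L ^ kk) (cvM d L mv kk hL) x ∈ cubeBlocks (cvM d L mv kk hL) (coverCorner (cvM d L mv kk hL) (L ^ mv) L (L * L ^ mv + 6 * L ^ mv - coverMargin L mv + 1) k) (L * L ^ mv + 16 * L ^ mv + 4)} ξ C) →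
      -- the FINE field (spacing `L^{−r}L^{−k}`) in the per-cube class on the locality boxes (NO relation to `U` assumed)
      ∀ (U' : Fin (d + 1) → ScX' d L mv kk r hL → (Matrix mm mm ℂ)ˣ), (∀ μ x, (U' μ x : Matrix mm mm ℂ) ∈ Matrix.unitaryGroup mm ℂ) →
      ∀ (ξ' C' : ℝ), 0 < ξ' → 0 < C' → C' / ξ' ≤ ε₀ → C' / ξ' ^ 2 ≤ ε₀ →
        (∀ k : Fin (d + 1) → ZMod (2 * L), Reg335Cube (scShift' d L mv kk r hL) U' ((((L ^ r * L ^ kk : ℕ) : ℝ))⁻¹) {x : ScX' d L mv kk r hL | blockOf (L ^ r * L ^ kk) (cvM d L mv kk hL) x ∈ cubeBlocks (cvM d L mv kk hL) (coverCorner (cvM d L mv kk hL) (L ^ mv) L (L * L ^ mv + 6 * L ^ mv - coverMargin L mv + 1) k) (L * L ^ mv + 16 * L ^ mv + 4)} ξ' C') →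
      -- Bałaban's operators on the two grids (named once)
      ∀ (A : (CvX d L mv kk hL × ι → ℝ) →ₗ[ℝ] (CvX d L mv kk hL × ι → ℝ)), A = covLapM (bshiftEquiv (cvM d L mv kk hL) (L ^ kk)) ((((L ^ kk : ℕ) : ℝ))⁻¹) (gaugePair (bshiftEquiv (cvM d L mv kk hL) (L ^ kk)) (fun μ x => coordMat e (ContinuousLinearMap.mulLeftRight ℝ (Matrix mm mm ℂ) ((U μ x.1 : Matrix mm mm ℂ)) ((U μ x.1 : Matrix mm mm ℂ))ᴴ))) + (cvNL d L mv kk hL a ι - cvNVq d L mv kk hL a ι e (fun μ x => (U μ x.1 : Matrix mm mm ℂ)) - cvNVr d L mv kk hL a ι e (fun μ x => (U μ x.1 : Matrix mm mm ℂ))) →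
      ∀ (A' : (CvX' d L mv kk r hL × ι → ℝ) →ₗ[ℝ] (CvX' d L mv kk r hL × ι → ℝ)), A' = covLapM (bshiftEquiv (cvM d L mv kk hL) (L ^ r * L ^ kk)) ((((L ^ r * L ^ kk : ℕ) : ℝ))⁻¹) (gaugePair (bshiftEquiv (cvM d L mv kk hL) (L ^ r * L ^ kk)) (fun μ x => coordMat e (ContinuousLinearMap.mulLeftRight ℝ (Matrix mm mm ℂ) ((U' μ x.1 : Matrix mm mm ℂ)) ((U' μ x.1 : Matrix mm mm ℂ))ᴴ))) + (cvNL' d L mv kk r hL a ι - cvNVq' d L mv kk r hL a ι e (fun μ x => (U' μ x.1 : Matrix mm mm ℂ)) - cvNVr' d L mv kk r hL a ι e (fun μ x => (U' μ x.1 : Matrix mm mm ℂ))) →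
        ∃ (G : (CvX d L mv kk hL × ι → ℝ) →ₗ[ℝ] (CvX d L mv kk hL × ι → ℝ)) (G' : (CvX' d L mv kk r hL × ι → ℝ) →ₗ[ℝ] (CvX' d L mv kk r hL × ι → ℝ)),
          HasMaj (CvNorm d L mv kk hL ι) (CvNorm d L mv kk hL ι) G (fun y y' => B * Real.exp (-(δ / 16 * (unitTorusGeo L kk (cvM d L mv kk hL)).dist y y'))) ∧ G ∘ₗ A = LinearMap.id ∧ A ∘ₗ G = LinearMap.id ∧
          HasMaj (BlockNorm.ofBlocks (unitTorusGeo L kk (cvM d L mv kk hL)) (liftBlk (cvBlk d L mv kk hL ∘ kingPrV L kk r (cvM d L mv kk hL)) ι)) (BlockNorm.ofBlocks (unitTorusGeo L kk (cvM d L mv kk hL)) (liftBlk (cvBlk d L mv kk hL ∘ kingPrV L kk r (cvM d L mv kk hL)) ι)) G' (fun y y' => B * Real.exp (-(δ / 16 * (unitTorusGeo L kk (cvM d L mv kk hL)).dist y y'))) ∧ G' ∘ₗ A' = LinearMap.id ∧ A' ∘ₗ G' = LinearMap.id ∧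
          ∀ (τ₁ τ₂ : (CvX d L mv kk hL × ι → ℝ) →ₗ[ℝ] (CvX' d L mv kk r hL × ι → ℝ)),
            -- the EXACT inverse rule: the η-defect of the propagators IS the sandwiched η-defect of the operators (transports swapped inside)
            idef τ₁ τ₂ G' G = -(G' ∘ₗ idef τ₂ τ₁ A' A ∘ₗ G) ∧
            -- rate = stability × consistency: any source-weighted majorant of the operator defect passes to the propagator defect
            ∀ (NΔ : Tor (cvM d L mv kk hL) → Tor (cvM d L mv kk hL) → ℝ) (mΔ ε : ℝ), (∀ x y, 0 ≤ NΔ x y) → 0 ≤ ε →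
              WRow (unitTorusGeo L kk (cvM d L mv kk hL)) (δ / 32) NΔ mΔ →
              HasMaj (CvNorm d L mv kk hL ι) (BlockNorm.ofBlocks (unitTorusGeo L kk (cvM d L mv kk hL)) (liftBlk (cvBlk d L mv kk hL ∘ kingPrV L kk r (cvM d L mv kk hL)) ι)) (idef τ₂ τ₁ A' A) (fun y y' => NΔ y y' * ε) →
              HasMaj (CvNorm d L mv kk hL ι) (BlockNorm.ofBlocks (unitTorusGeo L kk (cvM d L mv kk hL)) (liftBlk (cvBlk d L mv kk hL ∘ kingPrV L kk r (cvM d L mv kk hL)) ι)) (idef τ₁ τ₂ G' G) (fun y y' => (B * c₁) * (mΔ * B) * Real.exp (-(δ / 32 * (unitTorusGeo L kk (cvM d L mv kk hL)).dist y y')) * ε) := by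
  obtain ⟨δ, B, hδ, hB, H⟩ := exists_inverse_decay_of_reg335Cube_twoGrid (d := d) hL hL17 ha₀ ha ι
  have hc₁ : 0 < B4Sect5Proof.latticeConst (d + 1) (δ / 32) := by
    unfold B4Sect5Proof.latticeConst
    have hd : (0 : ℝ) < ((d + 1 : ℕ) : ℝ) := by exact_mod_cast Nat.succ_pos d
    have hlt : Real.exp (-(δ / 32 / ((d + 1 : ℕ) : ℝ))) < 1 := Real.exp_lt_one_iff.mpr (by have := div_pos (by positivity : (0 : ℝ) < δ / 32) hd; linarith)
    exact pow_pos (mul_pos (by norm_num) (inv_pos.mpr (by linarith))) _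
  refine ⟨δ, B, B4Sect5Proof.latticeConst (d + 1) (δ / 32), hδ, hB, hc₁, fun {mm} _ _ _ e he => ?_⟩
  obtain ⟨ε₀, w₂, hε₀, Hc, Hf⟩ := H e he
  refine ⟨ε₀, w₂, hε₀, fun mv kk r hk hw U hU ξ C hξ hC h1 h2 h335 U' hU' ξ' C' hξ' hC' h1' h2' h335' A hA A' hA' => ?_⟩
  obtain ⟨G, hG, hGl, hGr⟩ := Hc mv kk hk hw U hU ξ C hξ hC h1 h2 h335
  obtain ⟨G', hG', hGl', hGr'⟩ := Hf mv kk r hk hw U' hU' ξ' C' hξ' hC' h1' h2' h335'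
  subst hA hA'
  refine ⟨G, G', hG, hGl, hGr, hG', hGl', hGr', fun τ₁ τ₂ => ⟨idef_inv τ₁ τ₂ hGl' hGr, ?_⟩⟩
  intro NΔ mΔ ε hNΔ hε hmΔ hDΔ
  -- the unit-torus bookkeeping: triangle inequality, row sum (2.61) at rate δ/32, the G-kernel's weighted row norm, the constant (slow) weight ε
  have htri := triangle254_unitTorusGeo L kk (cvM d L mv kk hL)
  have hd0 : ∀ a b : (unitTorusGeo L kk (cvM d L mv kk hL)).Site, 0 ≤ (unitTorusGeo L kk (cvM d L mv kk hL)).dist a b := unitTorusGeo_dist_nonneg L kk (cvM d L mv kk hL)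
  have hρ : (0 : ℝ) ≤ δ / 32 := by positivity
  have hrow := rowSum_unitTorusGeo L kk (cvM d L mv kk hL) (σ := δ / 32) (by positivity)
  have hmG : WRow (unitTorusGeo L kk (cvM d L mv kk hL)) (δ / 32) (fun a b => B * Real.exp (-(δ / 16 * (unitTorusGeo L kk (cvM d L mv kk hL)).dist a b)))
      (B * B4Sect5Proof.latticeConst (d + 1) (δ / 32)) :=
    wrow_of_exp hd0 hrow hB.le (by linarith)
  have hNG : ∀ x y : (unitTorusGeo L kk (cvM d L mv kk hL)).Site, 0 ≤ B * Real.exp (-(δ / 16 * (unitTorusGeo L kk (cvM d L mv kk hL)).dist x y)) :=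
    fun x y => mul_nonneg hB.le (Real.exp_nonneg _)
  have hsw := slowWeight_const (g := unitTorusGeo L kk (cvM d L mv kk hL)) ε
  -- the coarse inverse at the rate δ/32 + 0
  have hG32 : HasMaj (CvNorm d L mv kk hL ι) (CvNorm d L mv kk hL ι) G (fun y y' => B * Real.exp (-((δ / 32 + 0) * (unitTorusGeo L kk (cvM d L mv kk hL)).dist y y'))) := by
    refine hG.mono fun y y' => mul_le_mul_of_nonneg_left (Real.exp_le_exp.mpr ?_) hB.le
    have := hd0 y y'
    nlinarith
  have hDΔ' : HasMaj (CvNorm d L mv kk hL ι) (BlockNorm.ofBlocks (unitTorusGeo L kk (cvM d L mv kk hL)) (liftBlk (cvBlk d L mv kk hL ∘ kingPrV L kk r (cvM d L mv kk hL)) ι))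
      (idef τ₂ τ₁ _ _) (fun y y' => NΔ y y' * (fun _ : (unitTorusGeo L kk (cvM d L mv kk hL)).Site => ε) y') := hDΔ
  have key := idef_inv_majorant (τ₁ := τ₁) (τ₂ := τ₂) htri hρ (fun _ => hε) hsw zero_le_one hB.le hNG hmG hNΔ hmΔ hGl' hGr hG' hDΔ' hG32
  refine key.mono fun y y' => le_of_eq ?_
  have hκ1 : (CvNorm d L mv kk hL ι).κ = 1 := rfl
  have hκ2 : (BlockNorm.ofBlocks (unitTorusGeo L kk (cvM d L mv kk hL)) (liftBlk (cvBlk d L mv kk hL ∘ kingPrV L kk r (cvM d L mv kk hL)) ι)).κ = 1 := rfl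
  rw [hκ1, hκ2]
  ring

end Resolvent

end Summit.QuantumFields.YangMills.BalabanUVNodes.N15.Gluing
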